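import Summits.NavierStokesRegularity.NavierStokesRegularity.Theorems.TypeIQuarterGateLorentzBoundOfEnvelope
import Literature.Analysis.FunctionSpaces.WeakLpQuantitative
import Mathlib.Analysis.SpecialFunctions.Integrals.Basic
import HarnessLib

/-!
# `TypeIQuarterGate`: the Lorentz bound leaves exactly a LOGARITHM on the octave cube

Quantitative datum linking the open stub `stub_lorentzUpgrade` = `LorentzUpgradeTypeI` (item 24108, line
`lorentz-upgrade` of the crux `QuarterLawTypeI`, stmt-NavierStokesRegularity-23726) to the slice-wise
octave budget SD of the sibling crux `ScarEnvelopeTypeI` (23843, line `slice_budget`): the endpoint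
`r = p = 3` of the tree's `MemWeakLp.setLIntegral_rpow_le` (`r < p`) / `lintegral_rpow_le_of_norm_le`
(`q > p`).

* `setLIntegral_cube_le_log_of_weakL3` — **weak-`L³` ∩ `L^∞` on a finite-volume set, the endpoint with a
  logarithm**: if `‖f‖ ≤ Λ` everywhere and `0 < λ₀ ≤ Λ`, then for every set `S`
  `∫_S ‖f‖³ ≤ μ(S)·λ₀³ + 3·log(Λ/λ₀) · sup_t t³ μ{t < ‖f‖}` (layer cake: levels `≤ λ₀` cost `μ(S)λ₀³`,
  levels in `(λ₀, Λ]` cost `3∫ t² · W t⁻³ dt = 3W log(Λ/λ₀)`, levels `> Λ` are empty).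
* `ballCube_le_log_of_rate_of_weakL3` — along a slice with the Type-I sup bound `‖u(t)‖ ≤ C/√(T−t)` and
  weak-`L³` cube `≤ M'` (the conclusion of `LorentzUpgradeTypeI`), the cube on a ball of radius `ℓ` with
  `√(T−t) ≤ C ℓ` obeys `∫_{B(a,ℓ)} ‖u(t)‖³ ≤ |B(0,1)| + 3 M' log(Cℓ/√(T−t))` — Barker–Prange's
  `log(ℓ²/(T−t))` shape (CMP 2021, Result 1 of the survey arXiv:2211.16215 p. 14), i.e. the Lorentz upgrade
  controls the octave cube of 23843's deciding stub SD up to EXACTLY ONE LOGARITHM, and no better by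
  weak-`L³` alone (`|x − a|⁻¹ ∈ L^{3,∞}` deposits `4π log(ℓ₂/ℓ₁)` of cube per shell).

HONEST FRAMING: measure-theoretic bookkeeping; `LorentzUpgradeTypeI`, `ScarEnvelopeTypeI`, `QuarterLawTypeI`
remain OPEN; nothing about Navier–Stokes regularity or blow-up is claimed. [folklore]
-/

-- the problem directory repeats the summit name (`NavierStokesRegularity/NavierStokesRegularity`)
set_option linter.dupNamespace false

noncomputable section

open Set Filter MeasureTheory Topology Metric
open scoped ENNReal NNReal

namespace Summit.NavierStokesRegularity.NavierStokesRegularity.Theorems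

namespace LorentzOfEnvelope

open Literature.Analysis.FluidPDE Literature.Analysis.FunctionSpaces

variable {α : Type*} [MeasurableSpace α] {F : Type*} [NormedAddCommGroup F]

/-! ### The logarithmic level integral -/

/-- `∫_{(λ₀, Λ]} t⁻¹ dt = log(Λ/λ₀)` as a lower integral of `ofReal` (`0 < λ₀ ≤ Λ`). [folklore] -/
theorem lintegral_Ioc_ofReal_inv {lam0 Lam : ℝ} (h0 : 0 < lam0) (hle : lam0 ≤ Lam) :
    ∫⁻ t in Ioc lam0 Lam, ENNReal.ofReal (t⁻¹) = ENNReal.ofReal (Real.log (Lam / lam0)) := by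
  have hLam : 0 < Lam := h0.trans_le hle
  have hint : IntervalIntegrable (fun t : ℝ => t⁻¹) volume lam0 Lam := by
    refine intervalIntegral.intervalIntegrable_inv (f := fun t : ℝ => t) (fun x hx => ?_)
      continuousOn_id
    rw [Set.uIcc_of_le hle] at hx
    exact (h0.trans_le hx.1).ne'
  have hnn : 0 ≤ᵐ[volume.restrict (Ioc lam0 Lam)] fun t : ℝ => t⁻¹ := by
    filter_upwards [ae_restrict_mem measurableSet_Ioc] with t ht
    exact inv_nonneg.2 (h0.trans ht.1).le
  rw [← ofReal_integral_eq_lintegral_ofReal hint.1 hnn, ← intervalIntegral.integral_of_le hle,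
    integral_inv_of_pos h0 hLam]

/-! ### The endpoint estimate -/

/-- **Weak-`L³` ∩ `L^∞` on a set: the cube with one logarithm.** If `‖f‖ ≤ Λ` everywhere and
`0 < λ₀ ≤ Λ`, then `∫_S ‖f‖³ dμ ≤ μ(S) λ₀³ + 3 log(Λ/λ₀) · sup_t t³ μ{t < ‖f‖}`. [folklore] -/
theorem setLIntegral_cube_le_log_of_weakL3 {f : α → F} {μ : Measure α}
    (hfm : AEStronglyMeasurable f μ) {Lam lam0 : ℝ} (h0 : 0 < lam0) (hle : lam0 ≤ Lam)
    (hsup : ∀ x, ‖f x‖ ≤ Lam) (S : Set α) :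
    ∫⁻ x in S, ‖f x‖ₑ ^ (3 : ℝ) ∂μ ≤
      μ S * ENNReal.ofReal (lam0 ^ 3) +
        ENNReal.ofReal (3 * Real.log (Lam / lam0)) * eWeakLpPow f 3 μ := by
  set W : ℝ≥0∞ := eWeakLpPow f 3 μ with hW_def
  -- layer cake on `μ|S`
  have hfmS : AEStronglyMeasurable f (μ.restrict S) := hfm.restrict
  rw [lintegral_enorm_rpow_eq_layerCake hfmS (by norm_num : (0 : ℝ) < 3)]
  -- pointwise bound of the level function by two indicators
  set Φ : ℝ → ℝ≥0∞ := fun t => μ.restrict S {a | t < ‖f a‖} * ENNReal.ofReal (t ^ ((3 : ℝ) - 1))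
    with hΦ_def
  have hΦle : ∀ t ∈ Ioi (0 : ℝ), Φ t ≤
      (Ioc 0 lam0).indicator (fun t => μ S * ENNReal.ofReal (t ^ (2 : ℝ))) t +
        (Ioc lam0 Lam).indicator (fun t => W * ENNReal.ofReal (t⁻¹)) t := by
    intro t ht
    have ht0 : 0 < t := ht
    have e2 : (3 : ℝ) - 1 = 2 := by norm_num
    simp only [hΦ_def, e2]
    rcases le_or_gt t lam0 with htl | htl
    · -- low levels: `μ|S {…} ≤ μ S`
      rw [indicator_of_mem (show t ∈ Ioc 0 lam0 from ⟨ht0, htl⟩)]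
      refine le_add_right (mul_le_mul' ?_ le_rfl)
      calc μ.restrict S {a | t < ‖f a‖} ≤ μ.restrict S univ := measure_mono (subset_univ _)
        _ = μ S := Measure.restrict_apply_univ S
    rcases le_or_gt t Lam with htL | htL
    · -- middle levels: Chebyshev `μ{t<‖f‖} ≤ W t⁻³`
      rw [indicator_of_notMem (fun h : t ∈ Ioc 0 lam0 => (not_le.2 htl) h.2),
        indicator_of_mem (show t ∈ Ioc lam0 Lam from ⟨htl, htL⟩), zero_add]
      have hcheb : μ.restrict S {a | t < ‖f a‖} ≤ W * ENNReal.ofReal (t ^ (-(3 : ℝ≥0∞).toReal)) :=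
        (Measure.restrict_apply_le S _).trans
          (meas_lt_norm_le_eWeakLpPow_mul_ofReal_rpow_neg f 3 μ ht0)
      calc μ.restrict S {a | t < ‖f a‖} * ENNReal.ofReal (t ^ (2 : ℝ))
          ≤ W * ENNReal.ofReal (t ^ (-(3 : ℝ≥0∞).toReal)) * ENNReal.ofReal (t ^ (2 : ℝ)) :=
            mul_le_mul' hcheb le_rfl
        _ = W * ENNReal.ofReal (t⁻¹) := by
            rw [mul_assoc, ← ENNReal.ofReal_mul (Real.rpow_nonneg ht0.le _)]
            congr 2
            rw [ENNReal.toReal_ofNat, ← Real.rpow_add ht0]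
            norm_num
            exact Real.rpow_neg_one t
    · -- high levels: empty superlevel set
      have hempty : {a | t < ‖f a‖} = ∅ :=
        eq_empty_of_forall_notMem fun a ha => (not_lt.2 ((hsup a).trans htL.le)) ha
      rw [hempty, measure_empty, zero_mul]
      exact zero_le
  -- integrate the two indicators
  have hm1 : Measurable ((Ioc (0 : ℝ) lam0).indicator fun t => μ S * ENNReal.ofReal (t ^ (2 : ℝ))) :=
    (measurable_const.mul (by fun_prop)).indicator measurableSet_Ioc
  have hsplit : ∫⁻ t in Ioi 0, Φ t ≤
      μ S * (∫⁻ t in Ioc 0 lam0, ENNReal.ofReal (t ^ (2 : ℝ))) +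
        W * ∫⁻ t in Ioc lam0 Lam, ENNReal.ofReal (t⁻¹) := by
    calc ∫⁻ t in Ioi 0, Φ t
        ≤ ∫⁻ t in Ioi 0, ((Ioc 0 lam0).indicator (fun t => μ S * ENNReal.ofReal (t ^ (2 : ℝ))) t +
            (Ioc lam0 Lam).indicator (fun t => W * ENNReal.ofReal (t⁻¹)) t) :=
          setLIntegral_mono' measurableSet_Ioi hΦle
      _ = (∫⁻ t in Ioc (0 : ℝ) lam0, μ S * ENNReal.ofReal (t ^ (2 : ℝ))) +
            ∫⁻ t in Ioc lam0 Lam, W * ENNReal.ofReal (t⁻¹) := by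
          rw [lintegral_add_left hm1, lintegral_indicator measurableSet_Ioc,
            lintegral_indicator measurableSet_Ioc, Measure.restrict_restrict measurableSet_Ioc,
            Measure.restrict_restrict measurableSet_Ioc,
            inter_eq_left.2 (Ioc_subset_Ioi_self : Ioc (0 : ℝ) lam0 ⊆ Ioi 0),
            inter_eq_left.2 ((Ioc_subset_Ioi_self.trans (Ioi_subset_Ioi h0.le)) :
              Ioc lam0 Lam ⊆ Ioi 0)]
      _ = μ S * (∫⁻ t in Ioc 0 lam0, ENNReal.ofReal (t ^ (2 : ℝ))) +
            W * ∫⁻ t in Ioc lam0 Lam, ENNReal.ofReal (t⁻¹) := by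
          rw [lintegral_const_mul'' _ (by fun_prop), lintegral_const_mul'' _ (by fun_prop)]
  rw [lintegral_Ioc_ofReal_rpow (by norm_num : (-1 : ℝ) < 2) h0, lintegral_Ioc_ofReal_inv h0 hle]
    at hsplit
  -- assemble: `3 · (μS λ₀³/3 + W log) = μS λ₀³ + 3 log · W`
  have hlog : 0 ≤ Real.log (Lam / lam0) := Real.log_nonneg ((one_le_div h0).2 hle)
  have e3 : ENNReal.ofReal (lam0 ^ ((2 : ℝ) + 1) / (2 + 1)) = ENNReal.ofReal (lam0 ^ 3 / 3) := by
    norm_num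
  rw [e3] at hsplit
  have eA : ENNReal.ofReal 3 * (μ S * ENNReal.ofReal (lam0 ^ 3 / 3)) =
      μ S * ENNReal.ofReal (lam0 ^ 3) := by
    rw [← mul_assoc, mul_comm (ENNReal.ofReal 3) (μ S), mul_assoc,
      ← ENNReal.ofReal_mul (by norm_num : (0 : ℝ) ≤ 3)]
    congr 2
    field_simp
  have eB : ENNReal.ofReal 3 * (W * ENNReal.ofReal (Real.log (Lam / lam0))) =
      ENNReal.ofReal (3 * Real.log (Lam / lam0)) * W := by
    rw [← mul_assoc, mul_comm (ENNReal.ofReal 3) W, mul_assoc,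
      ← ENNReal.ofReal_mul (by norm_num : (0 : ℝ) ≤ 3), mul_comm]
  calc ENNReal.ofReal 3 * ∫⁻ t in Ioi 0, Φ t
      ≤ ENNReal.ofReal 3 * (μ S * ENNReal.ofReal (lam0 ^ 3 / 3) +
          W * ENNReal.ofReal (Real.log (Lam / lam0))) := mul_le_mul' le_rfl hsplit
    _ = μ S * ENNReal.ofReal (lam0 ^ 3) +
          ENNReal.ofReal (3 * Real.log (Lam / lam0)) * W := by rw [mul_add, eA, eB]

/-! ### Along a Type-I slice: the octave cube with one logarithm -/

/-- **The Lorentz bound leaves one logarithm on the ball cube.** If a slice `v : ℝ³ → ℝ³` obeys the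
Type-I sup bound `‖v‖ ≤ C/s` (`s = √(T−t) > 0`) and has weak-`L³` cube `≤ M'`, then for every centre `a`
and radius `ℓ` with `s ≤ C ℓ`:
`∫_{B(a,ℓ)} ‖v‖³ ≤ |B(0,1)| + 3 M' log(C ℓ/s)` (levels `λ₀ = 1/ℓ`, `Λ = C/s`). [folklore] -/
theorem ballCube_le_log_of_rate_of_weakL3
    {v : EuclideanSpace ℝ (Fin 3) → EuclideanSpace ℝ (Fin 3)} (hv : AEStronglyMeasurable v volume)
    {C s M' ℓ : ℝ} (hs : 0 < s) (hℓ : 0 < ℓ) (hsC : s ≤ C * ℓ)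
    (hsup : ∀ x, ‖v x‖ ≤ C / s) (hW : eWeakLpPow v 3 volume ≤ ENNReal.ofReal M')
    (a : EuclideanSpace ℝ (Fin 3)) :
    ∫⁻ x in ball a ℓ, ‖v x‖ₑ ^ (3 : ℝ) ≤
      volume (ball (0 : EuclideanSpace ℝ (Fin 3)) 1) +
        ENNReal.ofReal (3 * M' * Real.log (C * ℓ / s)) := by
  have hle : ℓ⁻¹ ≤ C / s := by
    rw [inv_le_iff_one_le_mul₀ hℓ, div_mul_eq_mul_div, one_le_div hs]; linarith [mul_comm C ℓ]
  have h := setLIntegral_cube_le_log_of_weakL3 hv (inv_pos.2 hℓ) hle hsup (ball a ℓ)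
  refine h.trans ?_
  have hvol : volume (ball a ℓ) * ENNReal.ofReal (ℓ⁻¹ ^ 3) =
      volume (ball (0 : EuclideanSpace ℝ (Fin 3)) 1) := by
    rw [Measure.addHaar_ball volume a hℓ.le, finrank_euclideanSpace_fin, mul_comm,
      ← mul_assoc, ← ENNReal.ofReal_mul (by positivity),
      show ℓ⁻¹ ^ 3 * ℓ ^ 3 = 1 by field_simp, ENNReal.ofReal_one, one_mul]
  rw [hvol]
  refine add_le_add le_rfl ?_
  have hlog : 0 ≤ Real.log (C / s / ℓ⁻¹) := Real.log_nonneg ((one_le_div (inv_pos.2 hℓ)).2 hle)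
  calc ENNReal.ofReal (3 * Real.log (C / s / ℓ⁻¹)) * eWeakLpPow v 3 volume
      ≤ ENNReal.ofReal (3 * Real.log (C / s / ℓ⁻¹)) * ENNReal.ofReal M' := mul_le_mul' le_rfl hW
    _ = ENNReal.ofReal (3 * M' * Real.log (C * ℓ / s)) := by
        rw [← ENNReal.ofReal_mul (by positivity)]
        congr 1
        rw [show C / s / ℓ⁻¹ = C * ℓ / s by field_simp]
        ring

end LorentzOfEnvelope

end Summit.NavierStokesRegularity.NavierStokesRegularity.Theorems
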